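import Literature.MathematicalPhysics.QuantumFieldTheory.Balaban1983to89.B9CubeLettersInvReadDictB
import Literature.MathematicalPhysics.QuantumFieldTheory.Balaban1983to89.B9CoReadingCoords
import Literature.MathematicalPhysics.QuantumFieldTheory.Balaban1983to89.B9Thm33G0ProbeZeroAtPinsAdm
import Literature.MathematicalPhysics.QuantumFieldTheory.Balaban1983to89.B9GeoLemma21KLevelV1

/-!
# `Balaban1983to89.B9Local342GOfEBlockInvB` — T. Bałaban, *Propagators for lattice gauge theories in a background field*, Commun. Math. Phys. **99** (1985) 389–434
# [Balaban1985BackgroundPropagators], Thm 3.3 p. 399 with (3.42) p. 397 + Cor. 3.6 p. 408, BOND SECTOR: the four (3.42) entries of a bond-sector letter `O(U)` over the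
# gauge-invariant test class (`EBlock (kernelFamilyBInv i B cfg O par) B₀ δ U` — the currency of the tree's Cor-3.6 theorems for r05's bond cube letter `G_□`,
# `B9Cor36GCubeLocAtMemberClosed`) give the four [4]-(2.51) block majorants of `GcoK … O U`, `DcoK ∘ GcoK`, `GcoK ∘ DscoK`, `LcoK ∘ GcoK` over `blkBK bI` — the shapes of
# `B9Thm310Whole.Local342G` (rows 19 `h36A`); the bond-sector twin of `B9Local342OfEBlockInv`

[4] = T. Bałaban, *Propagators and renormalization transformations for lattice gauge theories. II*, Commun. Math. Phys. **96** (1984) 223–250 [`Balaban1984PropagatorsII`].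
statement-level skeleton of published theorems with citation tags; proofs where landed; nothing here is a claim about the Yang–Mills mass gap.

THE PRINT.  Thm 3.3 p. 399 (*«the operator G(U) (a = 1) satisfies the inequalities (3.42)–(3.47), with G′(U) replaced by G(U) and λ replaced by a function J defined at bonds»*);
(3.42) p. 397; Cor. 3.6 p. 408 + p. 409 l. 1–5 (the cube letters `G_□(U)` of the sequence `{Ω_n(□)}`); [4] (2.51) p. 232.

WHY THIS FILE (cell `pub-ymgap`, node N06 [B9], seat `pub-ymgap-dag-n06-c` g22; LOCATED-26 road (a), bond sector).  Rows 19 of the certificate display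
`h36A : Local342G (𝔬A x) …` — the four (3.42) entries of the bond-sector cube Green's functions `(𝔬A x).Gsq U j`, today only slot-pinned (`hGsqAS`); when the A-side walk letters
are pinned to r05's sequence letters (the twin of FILE C), lit-balaban's Cor-3.6 chain for the bond cube letter (`B9Cor36GCubeLocAtMemberClosed.eBlock_locLetterBY''` etc.)
delivers `EBlock (kernelFamilyBInv …)`, and THIS FILE reads it at the certificate's bond models (`GcoK ∕ DcoK ∕ DscoK ∕ LcoK`, pins `hGcoA hDcoA hDscoA hLcoA`), generic in the
letter `O : BondOpY 𝔸 i`, via r06's READ dictionary `B9CubeLettersInvReadDictB.norm_O_le_of_eBlockInvB` and its three siblings; test majorant `J = 𝟙_{Δ(x)=βy′}·b_b·|F|`; the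
carrier hypothesis `hβb : β (bI x) = Δ(x)` (the face's `hβI` on the section-carrying sub-family).  Constant `cR39 b·c_b·b_b·B₀`, same rate: ★★ `hasMajorant_GcoK_of_eBlockInvB` (e0,
`len²`), ★★ `hasMajorantHom_DcoK_GcoK_of_eBlockInvB` (e1, `len`), ★★ `hasMajorantHom_GcoK_DscoK_of_eBlockInvB` (e2, `len`), ★★ `hasMajorantHom_LcoK_GcoK_of_eBlockInvB` (e3, `1`).

HONEST SCOPE.  Dictionary algebra over landed readings; the (3.42) block is a HYPOTHESIS; nothing of [B9] asserted; COUNT-NEUTRAL; N06 NOT discharged; nothing continuum, nothing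
about the mass gap ∕ Clay.  A NEW file; 0 `def`, no `sorry`, no `axiom`, no `instance`, no `notation`.
-/

noncomputable section

namespace Literature.MathematicalPhysics.QuantumFieldTheory.Balaban1983to89.B9Local342GOfEBlockInvB

open Node00 (FBondY IBondY CfgY BondOpY BondParY cdB cdsB lapB)
open B6GlobalChartV1 (blkV1)
open B6Ineq2142KLevelV1 (β)
open B6KLevelCensusIndexV1 (KIdx)
open B6RandomWalk (HasMajorant BlockSupp)
open B6RandomWalkHom (HasMajorantHom)
open B9Thm34Ext (toB6)
open B9FromB6 (EBlock)
open B9GeoNormsKLevelV1 (geo9K)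
open B9Thm39ReadingCoords (cR39 cR39_nonneg coordBound39 basisBound39 abs_repr_le)
open B9CoReadingCoords (XBK assembleK coordOpK coordOpK_apply blkBK GcoK DcoK DscoK LcoK DcoK_comp_GcoK GcoK_comp_DscoK LcoK_comp_GcoK cdBₗ cdsBₗ lapBₗ
  cdBₗ_apply cdsBₗ_apply lapBₗ_apply)
open B9CubeLettersInvReadings (TestY kernelFamilyBInv)
open B9CubeLettersInvReadDictB (norm_O_le_of_eBlockInvB norm_cdB_O_le_of_eBlockInvB norm_O_cdsB_le_of_eBlockInvB norm_lapB_O_le_of_eBlockInvB)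
open B9Thm33G0ProbeZeroAtPinsAdm (norm_assembleK_le)

variable {d ℓ : ℕ} {hd : 1 ≤ d + 1} {hL : Odd (ℓ + 1) ∧ 1 < ℓ + 1} {b₀ b₁ : ℝ}
variable {𝔸 : Type} [NormedRing 𝔸] [NormedAlgebra ℂ 𝔸] [CompleteSpace 𝔸] [FiniteDimensional ℝ 𝔸]
variable {κ : Type} [Fintype κ]
variable (i : KIdx d ℓ hd hL b₀ b₁) [Fintype (geo9K i).Site] (b : Module.Basis κ ℝ 𝔸)
variable (B : B9.Backgrounds) (cfg : B.Cfg → CfgY 𝔸 i) (O : BondOpY 𝔸 i) (par : BondParY 𝔸 i)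
variable {R₀ : ℝ} {H₀ : Prop} {bI : FBondY i → IBondY i} {B₀ δ : ℝ} {U₁ : B.Cfg}

/-! ## §1 The test-class packaging of a block-supported bond coordinate vector -/

omit [CompleteSpace 𝔸] [FiniteDimensional ℝ 𝔸] in
/-- ★ **A BLOCK-SUPPORTED BOND COORDINATE VECTOR ASSEMBLES TO A MEMBER OF THE TEST CLASS**: if `F` is supported over `{q : blkBK bI q = y′}` with `|F| ≤ Bd` there, and every
fine bond's index block is its carrier block (`β (bI x) = Δ(x)`), then `Λ = assembleK b ν c F` satisfies `‖Λ(x)‖ ≤ J(x)` for the test majorant `J = 𝟙_{Δ(x) = βy′}·b_b·Bd`, supported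
in `Δ(βy′)` with `|J| ≤ b_b·Bd`. [cite: Balaban1985BackgroundPropagators, (3.39) + (3.42) p.397, Thm 3.3 p.399 («λ replaced by a function J defined at bonds»), bookkeeping] -/
theorem testY_of_blockSuppB (hβb : ∀ x : FBondY i, β i.hN i.D i.hk (bI x) = blkV1 i.hN i.D x)
    {y' : IBondY i} {F : XBK κ i → ℝ} {Bd : ℝ} (hF : BlockSupp (g := toB6 (geo9K i) R₀ H₀) (blkBK i bI) F y' Bd) (ν : Fin (d + 1)) (c : κ) :
    let J : FBondY i → ℝ := fun x => if blkV1 i.hN i.D x = β i.hN i.D i.hk y' then basisBound39 b * Bd else 0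
    (∀ x, ‖assembleK b ν c F x‖ ≤ |J x|) ∧ (geo9K i).suppIn (Sum.inr J) y' ∧ (geo9K i).supNorm (Sum.inr J) ≤ basisBound39 b * Bd := by
  classical
  intro J
  have hbb : 0 ≤ basisBound39 b := Finset.sum_nonneg fun _ _ => norm_nonneg _
  have hBd : 0 ≤ basisBound39 b * Bd := mul_nonneg hbb hF.nonneg
  refine ⟨fun x => ?_, fun x hx => ?_, ?_⟩
  · by_cases hx : bI x = y'
    · have hblk : blkV1 i.hN i.D x = β i.hN i.D i.hk y' := by rw [← hx]; exact (hβb x).symm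
      have hJ : J x = basisBound39 b * Bd := if_pos hblk
      rw [hJ, abs_of_nonneg hBd]
      exact norm_assembleK_le b ν c F x fun a => hF.bound (x, ν, a, c) hx
    · have h0 : assembleK b ν c F x = 0 := by
        unfold assembleK
        exact Finset.sum_eq_zero fun a _ => by rw [hF.off (x, ν, a, c) hx, zero_smul]
      rw [h0, norm_zero]
      exact abs_nonneg _
  · by_contra hne
    exact hx (if_neg hne)
  · show (⨆ x, |J x|) ≤ basisBound39 b * Bd
    refine Real.iSup_le (fun x => ?_) hBd
    by_cases h : blkV1 i.hN i.D x = β i.hN i.D i.hk y'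
    · show |J x| ≤ _
      rw [show J x = basisBound39 b * Bd from if_pos h, abs_of_nonneg hBd]
    · show |J x| ≤ _
      rw [show J x = 0 from if_neg h, abs_zero]; exact hBd

/-! ## §2 The four block majorants -/

omit [CompleteSpace 𝔸] [FiniteDimensional ℝ 𝔸] [Fintype (geo9K i).Site] in
/-- the value of a scaled bond coordinate model at a carrier point. [cite: Balaban1985BackgroundPropagators, (3.42) p.397, dictionary] -/
theorem smul_coordOpK_applyB (r : ℝ) (T : Fin (d + 1) → (FBondY i → 𝔸) →ₗ[ℝ] (FBondY i → 𝔸)) (F : XBK κ i → ℝ) (x : FBondY i) (ν : Fin (d + 1)) (a c : κ) :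
    (r • coordOpK b T) F (x, ν, a, c) = r * b.repr (T ν (assembleK b ν c F) x) a := by
  rw [LinearMap.smul_apply, Pi.smul_apply, smul_eq_mul, coordOpK_apply]

/-- ★★ **ENTRY 0 (bond sector): `HasMajorant (blkBK bI) (GcoK … O U) (cR39·c_b·b_b·B₀·len²·e^{−δd})`** from the (3.42) block of `O(U)` over the class.
[cite: Balaban1985BackgroundPropagators, Thm 3.3 p.399 with (3.42) p.397 (first member) + Cor. 3.6 p.408; Balaban1984PropagatorsII, (2.51) p.232] -/
theorem hasMajorant_GcoK_of_eBlockInvB (hE : EBlock (kernelFamilyBInv i B cfg O par) B₀ δ U₁) (hB₀ : 0 ≤ B₀)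
    (hβb : ∀ x : FBondY i, β i.hN i.D i.hk (bI x) = blkV1 i.hN i.D x) :
    HasMajorant (g := toB6 (geo9K i) R₀ H₀) (blkBK i bI) (GcoK i b B cfg O U₁)
      (fun a a' => cR39 b * coordBound39 b * basisBound39 b * B₀ * (geo9K i).len a ^ 2 * Real.exp (-(δ * (geo9K i).dist a a'))) := by
  classical
  have hcb : 0 ≤ coordBound39 b := by unfold coordBound39; exact norm_nonneg _
  intro y' F Bd hF q
  obtain ⟨x, ν, a, c⟩ := q
  obtain ⟨hΛ, hs, hsup⟩ := testY_of_blockSuppB i b (R₀ := R₀) (H₀ := H₀) hβb hF ν c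
  set Λ : TestY 𝔸 (fun x => if blkV1 i.hN i.D x = β i.hN i.D i.hk y' then basisBound39 b * Bd else 0) := ⟨assembleK b ν c F, hΛ⟩ with hΛdef
  have hx : blkV1 i.hN i.D x = β i.hN i.D i.hk (bI x) := (hβb x).symm
  have hpt := norm_O_le_of_eBlockInvB i b cfg O par hE hcb (abs_repr_le b) _ (bI x) y' hs Λ hx
  show |(GcoK i b B cfg O U₁) F (x, ν, a, c)| ≤ _
  rw [GcoK, smul_coordOpK_applyB]
  have hrep : |b.repr (O (cfg U₁) (assembleK b ν c F) x) a| ≤ coordBound39 b * ‖O (cfg U₁) (assembleK b ν c F) x‖ := abs_repr_le b _ a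
  rw [abs_mul, abs_of_nonneg (cR39_nonneg b)]
  calc cR39 b * |b.repr (O (cfg U₁) (assembleK b ν c F) x) a|
      ≤ cR39 b * (coordBound39 b * ‖O (cfg U₁) (assembleK b ν c F) x‖) := mul_le_mul_of_nonneg_left hrep (cR39_nonneg b)
    _ ≤ cR39 b * (coordBound39 b * (B₀ * (geo9K i).len (bI x) ^ 2 * Real.exp (-(δ * (geo9K i).dist (bI x) y')) * (basisBound39 b * Bd))) :=
        mul_le_mul_of_nonneg_left (mul_le_mul_of_nonneg_left (hpt.trans (mul_le_mul_of_nonneg_left hsup (by positivity))) hcb) (cR39_nonneg b)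
    _ = _ := by show _ = cR39 b * coordBound39 b * basisBound39 b * B₀ * (geo9K i).len (bI x) ^ 2 * Real.exp (-(δ * (geo9K i).dist (bI x) y')) * Bd; ring

/-- ★★ **ENTRY 1 (bond sector): `HasMajorantHom (blkBK bI) (blkBK bI) (DcoK U ∘ₗ GcoK O U) (cR39·c_b·b_b·B₀·len·e^{−δd})`**.
[cite: Balaban1985BackgroundPropagators, Thm 3.3 p.399 with (3.42) p.397 (second member) + Cor. 3.6 p.408; Balaban1984PropagatorsII, (2.51) p.232] -/
theorem hasMajorantHom_DcoK_GcoK_of_eBlockInvB (hE : EBlock (kernelFamilyBInv i B cfg O par) B₀ δ U₁) (hB₀ : 0 ≤ B₀)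
    (hβb : ∀ x : FBondY i, β i.hN i.D i.hk (bI x) = blkV1 i.hN i.D x) :
    HasMajorantHom (g := toB6 (geo9K i) R₀ H₀) (blkBK i bI) (blkBK i bI) (DcoK i b B cfg U₁ ∘ₗ GcoK i b B cfg O U₁)
      (fun a a' => cR39 b * coordBound39 b * basisBound39 b * B₀ * (geo9K i).len a * Real.exp (-(δ * (geo9K i).dist a a'))) := by
  classical
  have hcb : 0 ≤ coordBound39 b := by unfold coordBound39; exact norm_nonneg _
  intro y' F Bd hF q
  obtain ⟨x, ν, a, c⟩ := q
  obtain ⟨hΛ, hs, hsup⟩ := testY_of_blockSuppB i b (R₀ := R₀) (H₀ := H₀) hβb hF ν c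
  set Λ : TestY 𝔸 (fun x => if blkV1 i.hN i.D x = β i.hN i.D i.hk y' then basisBound39 b * Bd else 0) := ⟨assembleK b ν c F, hΛ⟩ with hΛdef
  have hx : blkV1 i.hN i.D x = β i.hN i.D i.hk (bI x) := (hβb x).symm
  have hpt := norm_cdB_O_le_of_eBlockInvB i b cfg O par hE hcb (abs_repr_le b) _ (bI x) y' hs Λ ν hx
  show |(DcoK i b B cfg U₁ ∘ₗ GcoK i b B cfg O U₁) F (x, ν, a, c)| ≤ _
  rw [DcoK_comp_GcoK, smul_coordOpK_applyB, LinearMap.comp_apply, LinearMap.restrictScalars_apply, cdBₗ_apply]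
  have hrep : |b.repr (cdB i (cfg U₁) ν (O (cfg U₁) (assembleK b ν c F)) x) a| ≤ coordBound39 b * ‖cdB i (cfg U₁) ν (O (cfg U₁) (assembleK b ν c F)) x‖ :=
    abs_repr_le b _ a
  have hlen0 : 0 ≤ B₀ * (geo9K i).len (bI x) * Real.exp (-(δ * (geo9K i).dist (bI x) y')) :=
    mul_nonneg (mul_nonneg hB₀ (B9GeoLemma21KLevelV1.geo9K_len_pos i _).le) (Real.exp_nonneg _)
  rw [abs_mul, abs_of_nonneg (cR39_nonneg b)]
  calc cR39 b * |b.repr (cdB i (cfg U₁) ν (O (cfg U₁) (assembleK b ν c F)) x) a|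
      ≤ cR39 b * (coordBound39 b * ‖cdB i (cfg U₁) ν (O (cfg U₁) (assembleK b ν c F)) x‖) := mul_le_mul_of_nonneg_left hrep (cR39_nonneg b)
    _ ≤ cR39 b * (coordBound39 b * (B₀ * (geo9K i).len (bI x) * Real.exp (-(δ * (geo9K i).dist (bI x) y')) * (basisBound39 b * Bd))) :=
        mul_le_mul_of_nonneg_left (mul_le_mul_of_nonneg_left (hpt.trans (mul_le_mul_of_nonneg_left hsup hlen0)) hcb) (cR39_nonneg b)
    _ = _ := by show _ = cR39 b * coordBound39 b * basisBound39 b * B₀ * (geo9K i).len (bI x) * Real.exp (-(δ * (geo9K i).dist (bI x) y')) * Bd; ring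

/-- ★★ **ENTRY 2 (bond sector): `HasMajorantHom (blkBK bI) (blkBK bI) (GcoK O U ∘ₗ DscoK U) (cR39·c_b·b_b·B₀·len·e^{−δd})`**.
[cite: Balaban1985BackgroundPropagators, Thm 3.3 p.399 with (3.42) p.397 (third member) + Cor. 3.6 p.408; Balaban1984PropagatorsII, (2.51) p.232] -/
theorem hasMajorantHom_GcoK_DscoK_of_eBlockInvB (hE : EBlock (kernelFamilyBInv i B cfg O par) B₀ δ U₁) (hB₀ : 0 ≤ B₀)
    (hβb : ∀ x : FBondY i, β i.hN i.D i.hk (bI x) = blkV1 i.hN i.D x) :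
    HasMajorantHom (g := toB6 (geo9K i) R₀ H₀) (blkBK i bI) (blkBK i bI) (GcoK i b B cfg O U₁ ∘ₗ DscoK i b B cfg U₁)
      (fun a a' => cR39 b * coordBound39 b * basisBound39 b * B₀ * (geo9K i).len a * Real.exp (-(δ * (geo9K i).dist a a'))) := by
  classical
  have hcb : 0 ≤ coordBound39 b := by unfold coordBound39; exact norm_nonneg _
  intro y' F Bd hF q
  obtain ⟨x, ν, a, c⟩ := q
  obtain ⟨hΛ, hs, hsup⟩ := testY_of_blockSuppB i b (R₀ := R₀) (H₀ := H₀) hβb hF ν c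
  set Λ : TestY 𝔸 (fun x => if blkV1 i.hN i.D x = β i.hN i.D i.hk y' then basisBound39 b * Bd else 0) := ⟨assembleK b ν c F, hΛ⟩ with hΛdef
  have hx : blkV1 i.hN i.D x = β i.hN i.D i.hk (bI x) := (hβb x).symm
  have hpt := norm_O_cdsB_le_of_eBlockInvB i b cfg O par hE hcb (abs_repr_le b) _ (bI x) y' hs Λ ν hx
  show |(GcoK i b B cfg O U₁ ∘ₗ DscoK i b B cfg U₁) F (x, ν, a, c)| ≤ _
  rw [GcoK_comp_DscoK, smul_coordOpK_applyB, LinearMap.comp_apply, LinearMap.restrictScalars_apply, cdsBₗ_apply]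
  have hrep : |b.repr (O (cfg U₁) (cdsB i (cfg U₁) ν (assembleK b ν c F)) x) a| ≤ coordBound39 b * ‖O (cfg U₁) (cdsB i (cfg U₁) ν (assembleK b ν c F)) x‖ :=
    abs_repr_le b _ a
  have hlen0 : 0 ≤ B₀ * (geo9K i).len (bI x) * Real.exp (-(δ * (geo9K i).dist (bI x) y')) :=
    mul_nonneg (mul_nonneg hB₀ (B9GeoLemma21KLevelV1.geo9K_len_pos i _).le) (Real.exp_nonneg _)
  rw [abs_mul, abs_of_nonneg (cR39_nonneg b)]
  calc cR39 b * |b.repr (O (cfg U₁) (cdsB i (cfg U₁) ν (assembleK b ν c F)) x) a|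
      ≤ cR39 b * (coordBound39 b * ‖O (cfg U₁) (cdsB i (cfg U₁) ν (assembleK b ν c F)) x‖) := mul_le_mul_of_nonneg_left hrep (cR39_nonneg b)
    _ ≤ cR39 b * (coordBound39 b * (B₀ * (geo9K i).len (bI x) * Real.exp (-(δ * (geo9K i).dist (bI x) y')) * (basisBound39 b * Bd))) :=
        mul_le_mul_of_nonneg_left (mul_le_mul_of_nonneg_left (hpt.trans (mul_le_mul_of_nonneg_left hsup hlen0)) hcb) (cR39_nonneg b)
    _ = _ := by show _ = cR39 b * coordBound39 b * basisBound39 b * B₀ * (geo9K i).len (bI x) * Real.exp (-(δ * (geo9K i).dist (bI x) y')) * Bd; ring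

/-- ★★ **ENTRY 3 (bond sector): `HasMajorantHom (blkBK bI) (blkBK bI) (LcoK U ∘ₗ GcoK O U) (cR39·c_b·b_b·B₀·e^{−δd})`**.
[cite: Balaban1985BackgroundPropagators, Thm 3.3 p.399 with (3.42) p.397 (fourth member) + Cor. 3.6 p.408; Balaban1984PropagatorsII, (2.51) p.232] -/
theorem hasMajorantHom_LcoK_GcoK_of_eBlockInvB (hE : EBlock (kernelFamilyBInv i B cfg O par) B₀ δ U₁) (hB₀ : 0 ≤ B₀)
    (hβb : ∀ x : FBondY i, β i.hN i.D i.hk (bI x) = blkV1 i.hN i.D x) :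
    HasMajorantHom (g := toB6 (geo9K i) R₀ H₀) (blkBK i bI) (blkBK i bI) (LcoK i b B cfg U₁ ∘ₗ GcoK i b B cfg O U₁)
      (fun a a' => cR39 b * coordBound39 b * basisBound39 b * B₀ * Real.exp (-(δ * (geo9K i).dist a a'))) := by
  classical
  have hcb : 0 ≤ coordBound39 b := by unfold coordBound39; exact norm_nonneg _
  intro y' F Bd hF q
  obtain ⟨x, ν, a, c⟩ := q
  obtain ⟨hΛ, hs, hsup⟩ := testY_of_blockSuppB i b (R₀ := R₀) (H₀ := H₀) hβb hF ν c
  set Λ : TestY 𝔸 (fun x => if blkV1 i.hN i.D x = β i.hN i.D i.hk y' then basisBound39 b * Bd else 0) := ⟨assembleK b ν c F, hΛ⟩ with hΛdef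
  have hx : blkV1 i.hN i.D x = β i.hN i.D i.hk (bI x) := (hβb x).symm
  have hpt := norm_lapB_O_le_of_eBlockInvB i b cfg O par hE hcb (abs_repr_le b) _ (bI x) y' hs Λ hx
  show |(LcoK i b B cfg U₁ ∘ₗ GcoK i b B cfg O U₁) F (x, ν, a, c)| ≤ _
  rw [LcoK_comp_GcoK, smul_coordOpK_applyB, LinearMap.comp_apply, LinearMap.restrictScalars_apply, lapBₗ_apply]
  have hrep : |b.repr (lapB i (cfg U₁) (O (cfg U₁) (assembleK b ν c F)) x) a| ≤ coordBound39 b * ‖lapB i (cfg U₁) (O (cfg U₁) (assembleK b ν c F)) x‖ :=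
    abs_repr_le b _ a
  rw [abs_mul, abs_of_nonneg (cR39_nonneg b)]
  calc cR39 b * |b.repr (lapB i (cfg U₁) (O (cfg U₁) (assembleK b ν c F)) x) a|
      ≤ cR39 b * (coordBound39 b * ‖lapB i (cfg U₁) (O (cfg U₁) (assembleK b ν c F)) x‖) := mul_le_mul_of_nonneg_left hrep (cR39_nonneg b)
    _ ≤ cR39 b * (coordBound39 b * (B₀ * 1 * Real.exp (-(δ * (geo9K i).dist (bI x) y')) * (basisBound39 b * Bd))) :=
        mul_le_mul_of_nonneg_left (mul_le_mul_of_nonneg_left (hpt.trans (mul_le_mul_of_nonneg_left hsup (by positivity))) hcb) (cR39_nonneg b)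
    _ = _ := by show _ = cR39 b * coordBound39 b * basisBound39 b * B₀ * Real.exp (-(δ * (geo9K i).dist (bI x) y')) * Bd; ring

end Literature.MathematicalPhysics.QuantumFieldTheory.Balaban1983to89.B9Local342GOfEBlockInvB

end
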